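import Summits.QuantumFields.YangMills.Theorems.SwapVirialDeficitBlowUpPeriodicTwoScaleWindow
import Summits.QuantumFields.YangMills.Theorems.SwapVirialDeficitBlowUpPeriodicTwoScaleFamily
import Summits.QuantumFields.YangMills.Theorems.SwapVirialDeficitTwoScaleCompactUniform
import HarnessLib

/-!
# The PERIODIC massive-mode rung, brick PM-IId (assembly): the two-scale LIMIT of `twoScaleVolume` and its UNIFORMITY on the annulus — from a pointwise input
# (free-hands support of ⟨stmt-QuantumFields-24196⟩ `SwapVirialDeficit.ToronSoftnessSharp`; composes ✓`twoScaleFibre` (LEAD g96, PM-I) with my ✓PM-IIc dominator,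
# ✓PM-IId-window freezing, Mathlib's `tendsto_measure_of_ae_tendsto_indicator` and ✓`twoScale_uniform_annulus`)

INPUT (pointwise, LEAD g96's side via ✓`eventually_twoScaleDeficit_le_iff` + PM-IIb′ + the follower-sign symmetry): for a.e. `ξ = (w′, y)`, eventually along
`(𝓝[>]0 ×ˢ 𝓝[>]0) ×ˢ 𝓝 a₀`, `twoScaleDeficit L u s a w′ y ≤ (u²s)² ↔ ξ ∈ S₀(a₀)` for a measurable limit set `S₀(a₀)`.
OUTPUT: ★ `mem_twoScaleFibre_iff` (the fibre = window ∩ deficit event, `u > 0`), ★★★ `tendsto_twoScaleVolume` (`twoScaleVolume L u s a → (vol³⊗vol^{Fol})(W₀ ∩ S₀(a₀))`,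
`W₀` = the frozen slabs `|x₀|, |y′₀|, |z₀| < 1`, `|re y_f| < 1`), `twoScaleLimit_le_dominator` (the limit is finite), ★★★ `twoScaleVolume_uniform_annulus` = BOTH HALVES OF (I3′) with
`M a := (vol³⊗vol^{Fol})(W₀ ∩ S₀ a)`, ready for ✓`relativeGap_fixedL_of_twoScaleLimit` (which then needs only `M` measurable and `∫M > 0`).  `eventually_of_puncturedPlane`
transports LEAD's `𝓝[{u ≠ 0 ∧ s ≠ 0}]`-eventualities to the two-scale filter.
HONEST LABEL: plumbing for a plan-level fixed-`L` rung of a DRAFT line; the pointwise input (PM-IIb′ null level, follower signs) is LEAD g96's and NOT proved here; ⟨24196⟩/⟨24497⟩ OPEN;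
own crux ⟨22884⟩ OPEN (blocked-on ⟨19935⟩); the Yang–Mills mass gap is NOT proved; no summit is proved by a line.  Width seat ym-line-sfw-p2-w3 g64 (cell ym-idea-1, free hands),
`--supports stmt-QuantumFields-24196`.  THEOREMS ONLY (0 `def`, 0 `sorry`), standard axioms.  References: [cite: Luscher1983, §2]; [cite: GonzalezarroyoAltes1988]; [folklore].
-/

set_option autoImplicit false

noncomputable section

open MeasureTheory Quaternion Set Filter Topology
open scoped Quaternion ENNReal
open Literature.MathematicalPhysics.QuantumLattice
open Literature.MathematicalPhysics.QuantumFieldTheory hiding SU2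
open Summit.QuantumFields.YangMills.Theorems.SwapTwistDeficit.ToronLog

attribute [local instance] Literature.Analysis.FluidPDE.Tao2016.quatMeasurableSpace
  Literature.Analysis.FluidPDE.Tao2016.quatBorelSpace
  Literature.MathematicalPhysics.QuantumLattice.secondCountableTopology_su2

namespace Summit.QuantumFields.YangMills.Theorems.SwapVirialDeficit.BlowUpRing

open Summit.QuantumFields.YangMills.Theorems.FemtoTransferGap
open Summit.QuantumFields.YangMills.Theorems.FemtoTransferGap.TT
open Summit.QuantumFields.YangMills.Theorems.SwapVirialDeficit.ZeroModeSigma (ball3 dilateIm)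
open Summit.QuantumFields.YangMills.Theorems.SwapVirialDeficit.ZeroModeGroup
open Summit.QuantumFields.YangMills.Theorems.SwapVirialDeficit.BlowUp (dil3P twoScale_uniform_annulus)

variable {L : ℕ} [NeZero L]

/-! ## §1 Filters and the fibre as window ∩ deficit event -/

omit [NeZero L] in
/-- The two-scale filter refines the punctured-plane neighbourhood filter used by ✓`eventually_twoScaleDeficit_le_iff`. [folklore] -/
theorem twoScaleFilter_le_puncturedPlane (a₀ : ℝ) :
    (𝓝[>] (0 : ℝ) ×ˢ 𝓝[>] (0 : ℝ)) ×ˢ 𝓝 a₀ ≤ 𝓝[{q : (ℝ × ℝ) × ℝ | q.1.1 ≠ 0 ∧ q.1.2 ≠ 0}] (((0 : ℝ), (0 : ℝ)), a₀) := by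
  have h1 : (𝓝[>] (0 : ℝ) ×ˢ 𝓝[>] (0 : ℝ)) ×ˢ 𝓝 a₀ = 𝓝[(Ioi (0 : ℝ) ×ˢ Ioi (0 : ℝ)) ×ˢ univ] (((0 : ℝ), (0 : ℝ)), a₀) := by
    rw [← nhdsWithin_univ, ← nhdsWithin_prod_eq, ← nhdsWithin_prod_eq]
  rw [h1]
  refine nhdsWithin_mono _ ?_
  rintro ⟨⟨u, s⟩, a⟩ ⟨⟨hu, hs⟩, -⟩
  exact ⟨(mem_Ioi.1 hu).ne', (mem_Ioi.1 hs).ne'⟩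

omit [NeZero L] in
/-- Transport of eventualities from `𝓝[{u ≠ 0 ∧ s ≠ 0}]((0,0),a₀)` to the two-scale filter. [folklore] -/
theorem eventually_of_puncturedPlane {a₀ : ℝ} {p : (ℝ × ℝ) × ℝ → Prop}
    (h : ∀ᶠ q in 𝓝[{q : (ℝ × ℝ) × ℝ | q.1.1 ≠ 0 ∧ q.1.2 ≠ 0}] (((0 : ℝ), (0 : ℝ)), a₀), p q) :
    ∀ᶠ q in (𝓝[>] (0 : ℝ) ×ˢ 𝓝[>] (0 : ℝ)) ×ˢ 𝓝 a₀, p q :=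
  h.filter_mono (twoScaleFilter_le_puncturedPlane a₀)

/-- ★ **The fibre is the window cut by the deficit event** (`u > 0`):
`ξ ∈ twoScaleFibre L u s a ↔ (dil3P (u²s) (S³_{u,1/u} ξ.1) ∈ ball3 ∧ ∀ f, ‖dilateIm (u²s) (ξ.2 f)‖ < 1) ∧ twoScaleDeficit L u s a ξ.1 ξ.2 ≤ (u²s)²`. [folklore] -/
theorem mem_twoScaleFibre_iff {u : ℝ} (hu : 0 < u) (s a : ℝ) (ξ : ((ℍ × ℍ) × ℍ) × (Fol L → ℍ)) :
    ξ ∈ twoScaleFibre L u s a ↔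
      (dil3P (u ^ 2 * s) (scaleQ3 u u⁻¹ ξ.1) ∈ ball3 ∧ ∀ i, ‖dilateIm (u ^ 2 * s) (ξ.2 i)‖ < 1) ∧
        twoScaleDeficit L u s a ξ.1 ξ.2 ≤ (u ^ 2 * s) ^ 2 := by
  simp only [twoScaleFibre, periodicBlowUpSet, Set.mem_setOf_eq, periodicBlowUpPoint_twoScale hu, twoScaleDeficit, and_assoc]

/-! ## §2 The two-scale limit of the fibre volume -/

/-- ★★★ **THE TWO-SCALE LIMIT OF `twoScaleVolume`.**  If for a.e. `ξ` the deficit event decides eventually as membership in a measurable `S₀`, then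
`twoScaleVolume L u s a → (vol³ ⊗ vol^{Fol})(W₀ ∩ S₀)` along `(𝓝[>]0 ×ˢ 𝓝[>]0) ×ˢ 𝓝 a₀` (`|a₀| ≤ 1`). [cite: Luscher1983, §2] -/
theorem tendsto_twoScaleVolume {a₀ : ℝ} (ha₀ : |a₀| ≤ 1) {S₀ : Set (((ℍ × ℍ) × ℍ) × (Fol L → ℍ))} (hS₀ : MeasurableSet S₀)
    (hpt : ∀ᵐ ξ : ((ℍ × ℍ) × ℍ) × (Fol L → ℍ) ∂((volume : Measure ((ℍ × ℍ) × ℍ)).prod (Measure.pi fun _ : Fol L => (volume : Measure ℍ))),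
      ∀ᶠ q : (ℝ × ℝ) × ℝ in (𝓝[>] (0 : ℝ) ×ˢ 𝓝[>] (0 : ℝ)) ×ˢ 𝓝 a₀,
        (twoScaleDeficit L q.1.1 q.1.2 q.2 ξ.1 ξ.2 ≤ (q.1.1 ^ 2 * q.1.2) ^ 2 ↔ ξ ∈ S₀)) :
    Tendsto (fun q : (ℝ × ℝ) × ℝ => twoScaleVolume L q.1.1 q.1.2 q.2) ((𝓝[>] (0 : ℝ) ×ˢ 𝓝[>] (0 : ℝ)) ×ˢ 𝓝 a₀)
      (𝓝 (((volume : Measure ((ℍ × ℍ) × ℍ)).prod (Measure.pi fun _ : Fol L => (volume : Measure ℍ)))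
        ({ξ | ((|ξ.1.1.1.re| < 1 ∧ |ξ.1.1.2.re| < 1) ∧ |ξ.1.2.re| < 1) ∧ ∀ i, |(ξ.2 i).re| < 1} ∩ S₀))) := by
  have hW : MeasurableSet {ξ : ((ℍ × ℍ) × ℍ) × (Fol L → ℍ) | ((|ξ.1.1.1.re| < 1 ∧ |ξ.1.1.2.re| < 1) ∧ |ξ.1.2.re| < 1) ∧ ∀ i, |(ξ.2 i).re| < 1} := by
    have hre : Measurable fun v : ℍ => |v.re| := Quaternion.continuous_re.measurable.abs
    refine ((((measurableSet_lt (hre.comp (measurable_fst.comp (measurable_fst.comp measurable_fst))) measurable_const).inter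
      (measurableSet_lt (hre.comp (measurable_snd.comp (measurable_fst.comp measurable_fst))) measurable_const)).inter
      (measurableSet_lt (hre.comp (measurable_snd.comp measurable_fst)) measurable_const)).inter ?_)
    show MeasurableSet {ξ : ((ℍ × ℍ) × ℍ) × (Fol L → ℍ) | ∀ i, |(ξ.2 i).re| < 1}
    rw [Set.setOf_forall]
    exact MeasurableSet.iInter fun i => measurableSet_lt (hre.comp ((measurable_pi_apply i).comp measurable_snd)) measurable_const
  unfold twoScaleVolume
  refine tendsto_measure_of_ae_tendsto_indicator ((𝓝[>] (0 : ℝ) ×ˢ 𝓝[>] (0 : ℝ)) ×ˢ 𝓝 a₀) (hW.inter hS₀)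
    (fun q => measurableSet_twoScaleFibre q.1.1 q.1.2 q.2) measurableSet_twoScaleDominator volume_twoScaleDominator_lt_top.ne
    (eventually_twoScaleFibre_subset ha₀) ?_
  have hu : ∀ᶠ q : (ℝ × ℝ) × ℝ in (𝓝[>] (0 : ℝ) ×ˢ 𝓝[>] (0 : ℝ)) ×ˢ 𝓝 a₀, 0 < q.1.1 :=
    (tendsto_fst.comp tendsto_fst).eventually self_mem_nhdsWithin
  filter_upwards [ae_eventually_mem_twoScaleWindow_iff (L := L) a₀, hpt] with ξ hwin hdef
  filter_upwards [hu, hwin, hdef] with q hq hw hd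
  rw [mem_twoScaleFibre_iff hq, Set.mem_inter_iff, Set.mem_setOf_eq, hw, hd]

/-- The two-scale limit is dominated: `(vol³ ⊗ vol^{Fol})(W₀ ∩ S₀) ≤ vol(dominator) < ∞`. [folklore] -/
theorem twoScaleLimit_le_dominator {a₀ : ℝ} (ha₀ : |a₀| ≤ 1) {S₀ : Set (((ℍ × ℍ) × ℍ) × (Fol L → ℍ))} (hS₀ : MeasurableSet S₀)
    (hpt : ∀ᵐ ξ : ((ℍ × ℍ) × ℍ) × (Fol L → ℍ) ∂((volume : Measure ((ℍ × ℍ) × ℍ)).prod (Measure.pi fun _ : Fol L => (volume : Measure ℍ))),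
      ∀ᶠ q : (ℝ × ℝ) × ℝ in (𝓝[>] (0 : ℝ) ×ˢ 𝓝[>] (0 : ℝ)) ×ˢ 𝓝 a₀,
        (twoScaleDeficit L q.1.1 q.1.2 q.2 ξ.1 ξ.2 ≤ (q.1.1 ^ 2 * q.1.2) ^ 2 ↔ ξ ∈ S₀)) :
    ((volume : Measure ((ℍ × ℍ) × ℍ)).prod (Measure.pi fun _ : Fol L => (volume : Measure ℍ)))
        ({ξ | ((|ξ.1.1.1.re| < 1 ∧ |ξ.1.1.2.re| < 1) ∧ |ξ.1.2.re| < 1) ∧ ∀ i, |(ξ.2 i).re| < 1} ∩ S₀) ≤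
      ((volume : Measure ((ℍ × ℍ) × ℍ)).prod (Measure.pi fun _ : Fol L => (volume : Measure ℍ)))
        ((((scaleQ3 1 (20 * (L : ℝ) ^ 2)⁻¹ ⁻¹' domSet4) ∪ {w : (ℍ × ℍ) × ℍ | w.1.1 = 0 ∨ w.1.2 = 0 ∨ w.2 = 0}) ×ˢ
          ((Set.univ.pi fun _ : Fol L => {y : ℍ | |y.re| < 1 ∧ ‖y.im‖ ≤ 12 * (L : ℝ) ^ 2 * Real.sqrt 1}) ∪ {y : Fol L → ℍ | ∃ i, y i = 0}))) := by
  have ht := tendsto_twoScaleVolume ha₀ hS₀ hpt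
  haveI : ((𝓝[>] (0 : ℝ) ×ˢ 𝓝[>] (0 : ℝ)) ×ˢ 𝓝 a₀).NeBot := Filter.prod_neBot.2 ⟨Filter.prod_neBot.2 ⟨inferInstance, inferInstance⟩, inferInstance⟩
  refine le_of_tendsto ht ?_
  filter_upwards [eventually_twoScaleFibre_subset (L := L) ha₀] with q hq
  exact measure_mono hq

/-! ## §3 Uniformity on the annulus = both halves of (I3′) -/

/-- ★★★ **(I3′) FROM THE POINTWISE INPUT.**  With `M a := (vol³ ⊗ vol^{Fol})(W₀ ∩ S₀ a)`: if at every `a₀` of the annulus `r₀ ≤ |a₀| ≤ 1` the deficit event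
decides eventually a.e. as membership in the measurable `S₀ a₀`, then for every `ε′ > 0` ONE `θ > 0` gives
`twoScaleVolume L u s a₀ ≤ M a₀ + ε′` and `M a₀ ≤ twoScaleVolume L u s a₀ + ε′` for all `a₀` in the annulus, `u, s ∈ (0, θ)`. [cite: Luscher1983, §2] -/
theorem twoScaleVolume_uniform_annulus {r₀ : ℝ} {S₀ : ℝ → Set (((ℍ × ℍ) × ℍ) × (Fol L → ℍ))} (hS₀ : ∀ a, MeasurableSet (S₀ a))
    (hpt : ∀ a₀ : ℝ, r₀ ≤ |a₀| → |a₀| ≤ 1 →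
      ∀ᵐ ξ : ((ℍ × ℍ) × ℍ) × (Fol L → ℍ) ∂((volume : Measure ((ℍ × ℍ) × ℍ)).prod (Measure.pi fun _ : Fol L => (volume : Measure ℍ))),
        ∀ᶠ q : (ℝ × ℝ) × ℝ in (𝓝[>] (0 : ℝ) ×ˢ 𝓝[>] (0 : ℝ)) ×ˢ 𝓝 a₀,
          (twoScaleDeficit L q.1.1 q.1.2 q.2 ξ.1 ξ.2 ≤ (q.1.1 ^ 2 * q.1.2) ^ 2 ↔ ξ ∈ S₀ a₀))
    {ε' : ℝ} (hε' : 0 < ε') :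
    ∃ θ > (0 : ℝ), ∀ a₀ : ℝ, r₀ ≤ |a₀| → |a₀| ≤ 1 → ∀ u ∈ Ioo (0 : ℝ) θ, ∀ s ∈ Ioo (0 : ℝ) θ,
      twoScaleVolume L u s a₀ ≤
          ((volume : Measure ((ℍ × ℍ) × ℍ)).prod (Measure.pi fun _ : Fol L => (volume : Measure ℍ)))
            ({ξ | ((|ξ.1.1.1.re| < 1 ∧ |ξ.1.1.2.re| < 1) ∧ |ξ.1.2.re| < 1) ∧ ∀ i, |(ξ.2 i).re| < 1} ∩ S₀ a₀) + ENNReal.ofReal ε' ∧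
        ((volume : Measure ((ℍ × ℍ) × ℍ)).prod (Measure.pi fun _ : Fol L => (volume : Measure ℍ)))
            ({ξ | ((|ξ.1.1.1.re| < 1 ∧ |ξ.1.1.2.re| < 1) ∧ |ξ.1.2.re| < 1) ∧ ∀ i, |(ξ.2 i).re| < 1} ∩ S₀ a₀) ≤
          twoScaleVolume L u s a₀ + ENNReal.ofReal ε' := by
  refine twoScale_uniform_annulus (W := twoScaleVolume L)
    (M := fun a => ((volume : Measure ((ℍ × ℍ) × ℍ)).prod (Measure.pi fun _ : Fol L => (volume : Measure ℍ)))
      ({ξ | ((|ξ.1.1.1.re| < 1 ∧ |ξ.1.1.2.re| < 1) ∧ |ξ.1.2.re| < 1) ∧ ∀ i, |(ξ.2 i).re| < 1} ∩ S₀ a))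
    (fun a₀ h1 h2 => ?_) (fun a₀ h1 h2 => tendsto_twoScaleVolume h2 (hS₀ a₀) (hpt a₀ h1 h2)) hε'
  exact ne_top_of_le_ne_top volume_twoScaleDominator_lt_top.ne (twoScaleLimit_le_dominator h2 (hS₀ a₀) (hpt a₀ h1 h2))

end Summit.QuantumFields.YangMills.Theorems.SwapVirialDeficit.BlowUpRing

end
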